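import Literature.Geometry.Symplectic.OrigamiUnfoldingProofs
import Literature.Geometry.Kaehler.ManifoldFormsPullback
import Mathlib.Analysis.SpecialFunctions.Complex.Circle
import HarnessLib

/-!
# The origami normal form of a fold: the collar `φ^*ω = p^*i^*ω + d(t² p^*α)` — named fact

A. Cannas da Silva, V. Guillemin, C. Woodward, *On the unfolding of folded symplectic structures*,
Math. Res. Lett. 7 (2000) 35–53, Thm. 1 [`CannasGuilleminWoodward2000`], in the origami form in
which it is quoted and used by A. Cannas da Silva, V. Guillemin, A. R. Pires, *Symplectic Origami*,
IMRN 2011 = arXiv:0909.4065 [`CannasdasilvaGuilleminPires2010`], proof of Prop. 2.8 (read, p. 6 of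
the arXiv text): "Let `𝒰` be a tubular neighborhood of `Z` … By [the folded Moser theorem of
Cannas da Silva–Guillemin–Woodward 2000, Thm. 1] there is a diffeomorphism
`φ : Z × (-ε, ε) → 𝒰` such that `φ^*ω = p^*i^*ω + d(t² p^*α)`, where `p : Z × (-ε, ε) → Z` is the
projection, `i : Z ↪ M` the inclusion, `t` the real coordinate on `(-ε, ε)` and `α` an
`S¹`-connection form for the null fibration `Z → B`."  (In the IMRN text: "Moser model".)

This is step (S1) of the unfolding (architecture in `OrigamiUnfoldingProofs.lean`), consumed by
the construction of the symplectic cut pieces (steps (S2)–(S4), the files `OrigamiCut*.lean`).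
It is stated here as a NAMED FACT over the tree's rendering `IsOrigamiForm` (`OrigamiForm.lean`):
for an origami form `so` on a compact 4-manifold with a smooth orientation `o` there are fold
data `(N, j, θ)` as in `IsOrigamiForm` (re-exported: the proof is free to reverse the principal
circle action, which it does so that the first-order coefficient of `ω` across the fold is
POSITIVE on the generator — the orientation-matching convention of Def. 2.2), a smooth invariant
`1`-form `α` on `N` with `α(X) = 1` on the fundamental vector field `X` of `θ` (a connection form
of the null fibration), `δ > 0` and a map `c : N × ℝ → M` which on the band `N × (-δ, δ)` is a
diffeomorphism onto an open neighbourhood of the fold (`C^∞`, injective, open image, invertible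
differential) with `c (n, 0) = j n`, carrying `N × (0, δ)` into the side `M⁺(o)` and `N × (-δ, 0)`
into `M⁻(o)` (`posSide`, `OrigamiUnfoldingProofs.lean`), and such that ON THE BAND the pulled-back
form is the model form of `OrigamiModelForm.lean`:

  `c^*so = (j^*so).pullback pr₁ + d(t² • α.pullback pr₁)`.

The tree proves the ingredients of the printed proof — kernel-adapted collar, zeroth-order
agreement with the model, the first-order coefficient, the relative Poincaré lemma and the
cancelled Moser vector (`OrigamiFoldCollar*.lean`, `OrigamiCollarModelAgreement.lean`,
`OrigamiFoldFirstOrder.lean`, `FibrePrimitive*.lean`, `MoserVectorFour.lean`,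
`CircleConnectionForm*.lean`); the time-dependent Moser flow and its invariance identity are the
remaining debt.  Nothing is asserted; users take `(h : exists_origamiCollarNormalForm)`.

## References

* [CannasGuilleminWoodward2000] A. Cannas da Silva, V. Guillemin, C. Woodward, *On the unfolding
  of folded symplectic structures*, Math. Res. Lett. 7 (2000) 35–53, Thm. 1.
* [CannasdasilvaGuilleminPires2010] A. Cannas da Silva, V. Guillemin, A. R. Pires, *Symplectic
  Origami*, IMRN 2011, 4252–4293 = arXiv:0909.4065, proof of Prop. 2.8 ("Moser model"), Def. 2.2.
-/

noncomputable section

open scoped Manifold ContDiff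
open Set
open Literature.Geometry.Kaehler
open Literature.Topology.FourManifolds (SmoothOrientation)

namespace Literature.Geometry.Symplectic

universe u

/-- **Origami normal form of the fold** (Cannas da Silva–Guillemin–Woodward 2000, Thm. 1, as used
in Cannas da Silva–Guillemin–Pires 2010, proof of Prop. 2.8: "there is a diffeomorphism
`φ : Z × (-ε, ε) → 𝒰` such that `φ^*ω = p^*i^*ω + d(t² p^*α)` … `α` an `S¹`-connection form for the
null fibration"), NAMED FACT.  Rendering (module docstring): for an origami form `so` on a compact
smooth 4-manifold with a smooth orientation `o`, there are fold data `(N, j, θ)` as in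
`IsOrigamiForm` (compact embedded folding hypersurface, free smooth circle action tangent to
`ker ω`), a smooth `θ`-invariant `1`-form `α` with `α(X) = 1` on the fundamental vector field,
`δ > 0` and `c : N × ℝ → M`, a diffeomorphism of `N × (-δ, δ)` onto an open neighbourhood of the
fold with `c (n, 0) = j n`, `c (N × (0, δ)) ⊆ M⁺(o)`, `c (N × (-δ, 0)) ⊆ M⁻(o)`, and
`c^*so = pr₁^*(j^*so) + d(t² pr₁^*α)` on the band.
[cite: CannasGuilleminWoodward2000, Thm. 1] -/
def exists_origamiCollarNormalForm : Prop :=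
  ∀ (M : Type u) [TopologicalSpace M] [T2Space M] [SecondCountableTopology M]
    [ChartedSpace (EuclideanSpace ℝ (Fin 4)) M] [IsManifold (𝓡 4) ∞ M] [CompactSpace M]
    (o : SmoothOrientation (𝓡 4) M) (so : MForm (𝓡 4) M ℝ 2), IsOrigamiForm so →
    ∃ (N : Type) (_ : TopologicalSpace N) (_ : ChartedSpace (EuclideanSpace ℝ (Fin 3)) N)
      (_ : IsManifold (𝓡 3) ∞ N) (_ : CompactSpace N) (j : N → M) (θ : Circle → N → N)
      (α : MForm (𝓡 3) N ℝ 1) (c : N × ℝ → M) (δ : ℝ),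
      IsFoldedForm so N j ∧
      ContMDiff ((𝓡 1).prod (𝓡 3)) (𝓡 3) ∞ (fun p : Circle × N => θ p.1 p.2) ∧
      (∀ n, θ 1 n = n) ∧ (∀ a b n, θ (a * b) n = θ a (θ b n)) ∧ (∀ a n, θ a n = n → a = 1) ∧
      (∀ (n : N) (w : TangentSpace (𝓡 4) (j n)),
        so (j n) ![mfderiv 𝓘(ℝ, ℝ) (𝓡 4) (fun t : ℝ => j (θ (Circle.exp t) n)) 0 (1 : ℝ), w] = 0) ∧
      IsSmoothForm α ∧
      (∀ (a : Circle) (n : N) (v : Fin 1 → TangentSpace (𝓡 3) n),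
        α (θ a n) (fun i => mfderiv (𝓡 3) (𝓡 3) (θ a) n (v i)) = α n v) ∧
      (∀ n : N, α n ![mfderiv 𝓘(ℝ, ℝ) (𝓡 3) (fun t : ℝ => θ (Circle.exp t) n) 0 (1 : ℝ)] = 1) ∧
      0 < δ ∧
      ContMDiffOn ((𝓡 3).prod 𝓘(ℝ, ℝ)) (𝓡 4) ∞ c (univ ×ˢ Ioo (-δ) δ) ∧
      (∀ n, c (n, 0) = j n) ∧
      InjOn c (univ ×ˢ Ioo (-δ) δ) ∧
      IsOpen (c '' (univ ×ˢ Ioo (-δ) δ)) ∧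
      (∀ (n : N) (t : ℝ), t ∈ Ioo (-δ) δ →
        Function.Bijective (mfderiv ((𝓡 3).prod 𝓘(ℝ, ℝ)) (𝓡 4) c (n, t))) ∧
      (∀ (n : N) (t : ℝ), t ∈ Ioo 0 δ → c (n, t) ∈ posSide o so ∧ c (n, -t) ∈ posSide (-o) so) ∧
      (∀ p ∈ univ ×ˢ Ioo (-δ) δ,
        so.pullback ((𝓡 3).prod 𝓘(ℝ, ℝ)) c p =
          ((so.pullback (𝓡 3) j).pullback ((𝓡 3).prod 𝓘(ℝ, ℝ)) (Prod.fst : N × ℝ → N) +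
            mextDeriv ((fun q : N × ℝ => q.2 ^ 2) •
              α.pullback ((𝓡 3).prod 𝓘(ℝ, ℝ)) (Prod.fst : N × ℝ → N))) p)

end Literature.Geometry.Symplectic

end
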